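import Mathlib.Analysis.Calculus.ContDiff.Operations
import Literature.Analysis.FluidPDE.CompressibleEulerImplosionRates
import Summits.AtomisticToContinuum.HydrodynamicLimit.Theorems.ImplosionDichotomyPolynomialCompressionIdealGasBridgeCalculus

/-!
# Stub 1 of the line `log-lipschitz-budget` (Type-I ideal-gas implosion), conditionally on the
CGSS rates fact

Third helper toward `stub_typeOneImplosion` of the line `log-lipschitz-budget` (crux
`ImplosionDichotomy.PolynomialCompression`, stmt-AtomisticToContinuum-12587), after the bridge
`isHardSphereEulerSolution_zero_of_isentropic` (`…IdealGasBridge`) and the rescaling /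
rate-free assembly `isIsentropicEulerSolution_rescale`,
`exists_smooth_isentropic_idealGasImplosion_of_thm12` (`…IdealGasBridgeCalculus`).

The stub asks for the σ = 0 reference solution of the line: smooth positive profiles, a classical
isentropic ideal-gas solution on `[0, T₁)` with unit-mass data, AND four rate clauses (Type-I
gradient bounds `C/(T₁ − t)` on `∂ᵢu₁` and `∂ᵢρ₁^{1/3}`; polynomial sup bounds on all derivatives
of order `≤ 6`; a polynomial density floor; core growth `c (T₁ − t)^{−β}`, `β > 0`). The rate-free
tree fact `Literature.Analysis.FluidPDE.CaolaboraEtAl2025_thm12_euler` cannot supply the rates;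
the named fact `Literature.Analysis.FluidPDE.CaolaboraEtAl2025_thm12_rates`
(`CompressibleEulerImplosionRates.lean`: Cao-Labora–Gómez-Serrano–Shi–Staffilani Thm 1.2 +
Rem 1.4–1.5 with the self-similar rates of their construction, `γ = 5/3`) does, for a solution of
arbitrary mass. This file transports everything through the unit-mass rescaling
`(t, ρ, u) ↦ (μt, μ³ρ, μu)`, `T₁ = T/μ`, `μ³ ∫ρ(0) = 1`:

* `stub_typeOneImplosion_of_rates : CaolaboraEtAl2025_thm12_rates → <stub_typeOneImplosion>`.

The rate clauses are scale-covariant with explicit constants: Type I keeps its constant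
(`μ · C/(T − μt) = C/(T₁ − t)` and `(μ³ρ)^{1/3} = μ ρ^{1/3}`); `Dⁿ lift(a f) = a Dⁿ lift f`
(Mathlib `iteratedFDeriv_const_smul_apply'`) and `(T − μt)^{−p} = μ^{−p}(T₁ − t)^{−p}` give the
polynomial bounds with constants `|a| Cₙ μ^{−pₙ}`; floor and core pick up `μ³ μ^{±p}`; the core
exponent is `β = 3(1 − 1/r) > 0` (`r > 1`).
-/

noncomputable section

namespace Summit.AtomisticToContinuum.HydrodynamicLimit.Theorems

open Set MeasureTheory Filter
open scoped ContDiff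
open Literature.MathematicalPhysics.KineticTheory
open Literature.Analysis.FunctionSpaces Literature.Analysis.FunctionSpaces.Torus
open Literature.Analysis.FluidPDE (IsIsentropicEulerSolution CaolaboraEtAl2025_thm12_rates)

/-! ## Scalar bookkeeping for the time dilation `t ↦ μ t` -/

/-- `T − μ t = μ (T/μ − t)` for `μ ≠ 0`. [folklore] -/
theorem sub_mul_eq_mul_div_sub {T μ t : ℝ} (hμ : μ ≠ 0) : T - μ * t = μ * (T / μ - t) := by
  rw [mul_sub, mul_div_cancel₀ T hμ]

/-- `μ · (C / (T − μt)) = C / (T/μ − t)` for `μ ≠ 0`: a Type-I bound `C/(T − s)` at time `s = μt`,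
multiplied by the dilation factor `μ`, is the Type-I bound with the SAME constant for the dilated
clock `T₁ = T/μ`. [folklore] -/
theorem mul_div_sub_mul_eq {T μ t C : ℝ} (hμ : μ ≠ 0) :
    μ * (C / (T - μ * t)) = C / (T / μ - t) := by
  rw [sub_mul_eq_mul_div_sub hμ, ← mul_div_assoc, mul_div_mul_left C _ hμ]

/-- `(T − μt)^p = μ^p (T/μ − t)^p` for `μ > 0` and `t ≤ T/μ`. [folklore] -/
theorem sub_mul_rpow_eq {T μ t p : ℝ} (hμ : 0 < μ) (ht : t ≤ T / μ) :
    (T - μ * t) ^ p = μ ^ p * (T / μ - t) ^ p := by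
  rw [sub_mul_eq_mul_div_sub hμ.ne', Real.mul_rpow hμ.le (sub_nonneg.2 ht)]

/-- `(μ³)^{1/3} = μ` for `μ > 0`. [folklore] -/
theorem pow_three_rpow_one_third {μ : ℝ} (hμ : 0 < μ) : (μ ^ 3) ^ (1 / 3 : ℝ) = μ := by
  rw [← Real.rpow_natCast μ 3, ← Real.rpow_mul hμ.le,
    show ((3 : ℕ) : ℝ) * (1 / 3) = 1 by norm_num, Real.rpow_one]

/-! ## Pointwise torus calculus of constant multiples (no differentiability needed) -/

/-- `∂ᵢ(c • f)(x) = c • ∂ᵢf(x)` on the torus, for any `f` (Mathlib `deriv_fun_const_smul_field`).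
[folklore] -/
-- adapted from Literature/Analysis/FluidPDE/LerayHopfTimeSliceTorus.lean (`partialDeriv_const_smul_apply`)
theorem partialDeriv_const_smul_pt {F : Type*} [NormedAddCommGroup F] [NormedSpace ℝ F]
    (c : ℝ) (f : T3 → F) (i : Fin 3) (x : T3) :
    partialDeriv i (fun y => c • f y) x = c • partialDeriv i f x := by
  simp only [partialDeriv, Torus.lineDeriv]
  exact deriv_fun_const_smul_field c
    (fun s : ℝ => f (x + proj (s • EuclideanSpace.single i (1 : ℝ))))

/-- `∂ᵢ(c f)(x) = c ∂ᵢf(x)` on the torus, for any real `f`. [folklore] -/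
-- adapted from Literature/Analysis/FunctionSpaces/TorusRieszTransformProofs.lean (`partialDeriv_const_mul`)
theorem partialDeriv_const_mul_pt (c : ℝ) (f : T3 → ℝ) (i : Fin 3) (x : T3) :
    partialDeriv i (fun y => c * f y) x = c * partialDeriv i f x := by
  have h := partialDeriv_const_smul_pt c f i x
  simpa only [smul_eq_mul] using h

/-! ## Transport of the rate clauses through the rescaling `(t, ρ, u) ↦ (μt, μ³ρ, μu)` -/

variable {T μ : ℝ} {ρ : ℝ → T3 → ℝ} {u : ℝ → T3 → V3}

/-- Type-I velocity gradients are scale-covariant: `∂ᵢ[μ u(μt)] = μ ∂ᵢu(μt)`, and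
`μ · C/(T − μt) = C/(T/μ − t)`. [folklore] -/
theorem typeI_velocity_rescale (hμ : 0 < μ) {C t : ℝ} {x : T3} {i : Fin 3}
    (h : ‖partialDeriv i (u (μ * t)) x‖ ≤ C / (T - μ * t)) :
    ‖partialDeriv i (fun y => μ • u (μ * t) y) x‖ ≤ C / (T / μ - t) := by
  rw [partialDeriv_const_smul_pt, norm_smul, Real.norm_of_nonneg hμ.le, ← mul_div_sub_mul_eq hμ.ne']
  exact mul_le_mul_of_nonneg_left h hμ.le

/-- Type-I sound-speed gradients are scale-covariant: `(μ³ρ)^{1/3} = μ ρ^{1/3}` (`ρ ≥ 0`), so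
`∂ᵢ[(μ³ρ(μt))^{1/3}] = μ ∂ᵢ[ρ(μt)^{1/3}]`. [folklore] -/
theorem typeI_density_rescale (hμ : 0 < μ) {C t : ℝ} {x : T3} {i : Fin 3}
    (hpos : ∀ y, 0 ≤ ρ (μ * t) y)
    (h : |partialDeriv i (fun y => ρ (μ * t) y ^ (1 / 3 : ℝ)) x| ≤ C / (T - μ * t)) :
    |partialDeriv i (fun y => (μ ^ 3 * ρ (μ * t) y) ^ (1 / 3 : ℝ)) x| ≤ C / (T / μ - t) := by
  have hfun : (fun y => (μ ^ 3 * ρ (μ * t) y) ^ (1 / 3 : ℝ)) =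
      fun y => μ * ρ (μ * t) y ^ (1 / 3 : ℝ) := by
    funext y
    rw [Real.mul_rpow (pow_pos hμ 3).le (hpos y), pow_three_rpow_one_third hμ]
  rw [hfun, partialDeriv_const_mul_pt, abs_mul, abs_of_pos hμ, ← mul_div_sub_mul_eq hμ.ne']
  exact mul_le_mul_of_nonneg_left h hμ.le

/-- Derivatives of the lift of a constant multiple: `‖Dⁿ lift(a f)(y)‖ = |a| ‖Dⁿ lift f (y)‖` for
smooth `f` on the torus. [folklore] -/
theorem norm_iteratedFDeriv_lift_const_smul {F : Type*} [NormedAddCommGroup F] [NormedSpace ℝ F]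
    {f : T3 → F} (hf : Torus.IsSmooth f) (a : ℝ) (n : ℕ) (y : EuclideanSpace ℝ (Fin 3)) :
    ‖iteratedFDeriv ℝ n (Torus.lift (fun x => a • f x)) y‖ =
      |a| * ‖iteratedFDeriv ℝ n (Torus.lift f) y‖ := by
  have hcd : ContDiffAt ℝ n (Torus.lift f) y :=
    (ContDiff.of_le hf (by exact_mod_cast le_top)).contDiffAt
  have hEq : Torus.lift (fun x => a • f x) = fun z => a • Torus.lift f z := rfl
  rw [hEq, iteratedFDeriv_const_smul_apply' hcd, norm_smul, Real.norm_eq_abs]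

/-- Transport of a polynomial derivative bound through the rescaling: if
`‖Dⁿ lift f (y)‖ ≤ Cₙ (T − μt)^{−p}` then `‖Dⁿ lift(a f)(y)‖ ≤ (|a| Cₙ μ^{−p}) (T/μ − t)^{−p}`
(`μ > 0`, `t ≤ T/μ`). [folklore] -/
theorem polyBound_rescale {F : Type*} [NormedAddCommGroup F] [NormedSpace ℝ F]
    {f : T3 → F} (hf : Torus.IsSmooth f) (a : ℝ) {n : ℕ} {y : EuclideanSpace ℝ (Fin 3)}
    (hμ : 0 < μ) {t Cn p : ℝ} (ht : t ≤ T / μ)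
    (h : ‖iteratedFDeriv ℝ n (Torus.lift f) y‖ ≤ Cn * (T - μ * t) ^ (-p)) :
    ‖iteratedFDeriv ℝ n (Torus.lift (fun x => a • f x)) y‖ ≤
      (|a| * Cn * μ ^ (-p)) * (T / μ - t) ^ (-p) := by
  rw [norm_iteratedFDeriv_lift_const_smul hf a n y]
  rw [sub_mul_rpow_eq hμ ht] at h
  calc |a| * ‖iteratedFDeriv ℝ n (Torus.lift f) y‖
      ≤ |a| * (Cn * (μ ^ (-p) * (T / μ - t) ^ (-p))) := mul_le_mul_of_nonneg_left h (abs_nonneg a)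
    _ = (|a| * Cn * μ ^ (-p)) * (T / μ - t) ^ (-p) := by ring

/-- **Stub 1 of the line `log-lipschitz-budget`, conditionally on the CGSS rates fact.** Assuming
`CaolaboraEtAl2025_thm12_rates` (Cao-Labora–Gómez-Serrano–Shi–Staffilani Thm 1.2 + Rem 1.4–1.5
with the self-similar rates read off their construction, `γ = 5/3`): smooth positive profiles
`(a₀, u₀, θ₀)` on `𝕋³` and a classical solution `(ρ₁, u₁, θ₁)` of the full hard-sphere Euler
system at `σ = 0` on `[0, T₁)` with unit-mass data `(a₀/∫a₀, u₀, θ₀)`, isentropic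
(`θ₁ = (3/5)ρ₁^{2/3}`), with Type-I gradient bounds, polynomial bounds on all derivatives of
order `≤ 6`, a polynomial density floor and core growth `c (T₁ − t)^{−β}`, `β = 3(1 − 1/r) > 0`.
Proof: as `exists_smooth_isentropic_idealGasImplosion_of_thm12` — rescale to unit mass by
`isIsentropicEulerSolution_rescale` (`μ³ ∫ρ(0) = 1`), bridge to the full system by
`isHardSphereEulerSolution_zero_of_isentropic`, take time-`0` slices as profiles — and transport
the four rate clauses through `(t, ρ, u) ↦ (μt, μ³ρ, μu)`, `T₁ = T/μ`: Type I keeps its constant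
(`μ · C/(T − μt) = C/(T₁ − t)`, `(μ³ρ)^{1/3} = μρ^{1/3}`), `Dⁿ lift(μ³ρ) = μ³ Dⁿ lift ρ` and
`(T − μt)^{−p} = μ^{−p}(T₁ − t)^{−p}`, floor and core likewise. [folklore] -/
theorem stub_typeOneImplosion_of_rates :
    Literature.Analysis.FluidPDE.CaolaboraEtAl2025_thm12_rates →
      ∃ (a₀ θ₀ : T3 → ℝ) (u₀ : T3 → V3), Torus.IsSmooth a₀ ∧ Torus.IsSmooth θ₀ ∧ Torus.IsSmooth u₀ ∧
        (∀ x, 0 < a₀ x) ∧ (∀ x, 0 < θ₀ x) ∧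
        ∃ (T₁ K : ℝ) (ρ₁ θ₁ : ℝ → T3 → ℝ) (u₁ : ℝ → T3 → V3), 0 < T₁ ∧ 0 < K ∧
          IsHardSphereEulerSolution 0 T₁ ρ₁ u₁ θ₁ ∧
          (∀ x, ρ₁ 0 x = a₀ x / ∫ y, a₀ y) ∧ u₁ 0 = u₀ ∧ θ₁ 0 = θ₀ ∧
          (∀ t ∈ Ico 0 T₁, ∀ x, θ₁ t x = K * ρ₁ t x ^ (2 / 3 : ℝ)) ∧
          (∃ C : ℝ, ∀ t ∈ Ico 0 T₁, ∀ x, ∀ i : Fin 3,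
              ‖Torus.partialDeriv i (u₁ t) x‖ ≤ C / (T₁ - t) ∧
              |Torus.partialDeriv i (fun y => ρ₁ t y ^ (1 / 3 : ℝ)) x| ≤ C / (T₁ - t)) ∧
          (∀ n : ℕ, n ≤ 6 → ∃ Cn pn : ℝ, ∀ t ∈ Ico 0 T₁, ∀ y : EuclideanSpace ℝ (Fin 3),
              ‖iteratedFDeriv ℝ n (Torus.lift (ρ₁ t)) y‖ ≤ Cn * (T₁ - t) ^ (-pn) ∧
              ‖iteratedFDeriv ℝ n (Torus.lift (u₁ t)) y‖ ≤ Cn * (T₁ - t) ^ (-pn)) ∧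
          (∃ cl pl : ℝ, 0 < cl ∧ ∀ t ∈ Ico 0 T₁, ∀ x, cl * (T₁ - t) ^ pl ≤ ρ₁ t x) ∧
          ∃ β c : ℝ, 0 < β ∧ 0 < c ∧ ∀ t ∈ Ico 0 T₁, ∃ x, c * (T₁ - t) ^ (-β) ≤ ρ₁ t x := by
  rintro ⟨T, r, hT, hr, ρ, u, hsol, ⟨C, hC⟩, hreg, ⟨cl, pl, hcl, hfloor⟩, ⟨c, hc, hcore⟩⟩
  have h0 : (0 : ℝ) ∈ Ico 0 T := ⟨le_rfl, hT⟩
  -- the mass of the time-`0` slice and the normalising dilation factor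
  set m : ℝ := ∫ y, ρ 0 y with hm_def
  have hm : 0 < m :=
    integral_pos_of_continuous_pos (hsol.smooth_density.isSmooth_slice h0).continuous
      (hsol.density_pos 0 h0)
  set μ : ℝ := m ^ (-(1 / 3) : ℝ) with hμ_def
  have hμ : 0 < μ := Real.rpow_pos_of_pos hm _
  have hμ3 : μ ^ 3 * m = 1 := by
    rw [hμ_def, ← Real.rpow_natCast, ← Real.rpow_mul hm.le,
      show -(1 / 3 : ℝ) * ((3 : ℕ) : ℝ) = -1 by norm_num, Real.rpow_neg_one, inv_mul_cancel₀ hm.ne']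
  have hμ3pos : 0 < μ ^ 3 := pow_pos hμ 3
  -- the rescaled isentropic solution and the full ideal-gas solution
  have hres := isIsentropicEulerSolution_rescale hsol hμ
  have hfull := isHardSphereEulerSolution_zero_of_isentropic hres
  have hT₁ : 0 < T / μ := div_pos hT hμ
  have h0' : (0 : ℝ) ∈ Ico 0 (T / μ) := ⟨le_rfl, hT₁⟩
  refine ⟨fun x => μ ^ 3 * ρ (μ * 0) x, fun x => 3 / 5 * (μ ^ 3 * ρ (μ * 0) x) ^ (2 / 3 : ℝ),
    fun x => μ • u (μ * 0) x, hres.smooth_density.isSmooth_slice h0',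
    hfull.smooth_temperature.isSmooth_slice h0', hres.smooth_velocity.isSmooth_slice h0',
    hres.density_pos 0 h0', hfull.temperature_pos 0 h0', T / μ, 3 / 5, _, _, _, hT₁, by norm_num,
    hfull, fun x => ?_, rfl, rfl, fun t _ x => rfl, ⟨C, fun t ht x i => ?_⟩, fun n hn => ?_,
    ⟨μ ^ 3 * cl * μ ^ pl, pl, by positivity, fun t ht x => ?_⟩,
    ⟨3 * (1 - 1 / r), μ ^ 3 * c * μ ^ (-(3 * (1 - 1 / r))), ?_, by positivity, fun t ht => ?_⟩⟩
  · -- unit mass: `∫ μ³ ρ(0) = μ³ m = 1`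
    have hint : ∫ y, μ ^ 3 * ρ (μ * 0) y = 1 := by
      rw [integral_const_mul, mul_zero, ← hm_def, hμ3]
    rw [hint, div_one]
  · -- Type I
    have hμt := mul_mem_Ico_of_mem_Ico_div hμ ht
    obtain ⟨hu_b, hρ_b⟩ := hC (μ * t) hμt x i
    exact ⟨typeI_velocity_rescale hμ hu_b,
      typeI_density_rescale hμ (fun y => (hsol.density_pos _ hμt y).le) hρ_b⟩
  · -- polynomial bounds on derivatives of order `≤ 6`
    obtain ⟨Cn, pn, hb⟩ := hreg n hn
    refine ⟨max (|μ ^ 3| * Cn * μ ^ (-pn)) (|μ| * Cn * μ ^ (-pn)), pn, fun t ht y => ?_⟩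
    have hμt := mul_mem_Ico_of_mem_Ico_div hμ ht
    obtain ⟨hρn, hun⟩ := hb (μ * t) hμt y
    have hnn : 0 ≤ (T / μ - t) ^ (-pn) := Real.rpow_nonneg (sub_nonneg.2 ht.2.le) _
    have hρs : Torus.IsSmooth (ρ (μ * t)) := hsol.smooth_density.isSmooth_slice hμt
    have hus : Torus.IsSmooth (u (μ * t)) := hsol.smooth_velocity.isSmooth_slice hμt
    have h1 := polyBound_rescale hρs (μ ^ 3) hμ ht.2.le hρn
    have h2 := polyBound_rescale hus μ hμ ht.2.le hun
    simp only [smul_eq_mul] at h1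
    exact ⟨h1.trans (mul_le_mul_of_nonneg_right (le_max_left _ _) hnn),
      h2.trans (mul_le_mul_of_nonneg_right (le_max_right _ _) hnn)⟩
  · -- polynomial density floor
    have hμt := mul_mem_Ico_of_mem_Ico_div hμ ht
    have hfl := hfloor (μ * t) hμt x
    rw [sub_mul_rpow_eq hμ ht.2.le] at hfl
    calc μ ^ 3 * cl * μ ^ pl * (T / μ - t) ^ pl = μ ^ 3 * (cl * (μ ^ pl * (T / μ - t) ^ pl)) := by
          ring
      _ ≤ μ ^ 3 * ρ (μ * t) x := mul_le_mul_of_nonneg_left hfl hμ3pos.le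
  · -- `β = 3(1 − 1/r) > 0`
    have h1r : 1 / r < 1 := (div_lt_one (lt_trans one_pos hr)).2 hr
    nlinarith
  · -- core growth at the self-similar rate
    have hμt := mul_mem_Ico_of_mem_Ico_div hμ ht
    obtain ⟨x, hx⟩ := hcore (μ * t) hμt
    refine ⟨x, ?_⟩
    rw [sub_mul_rpow_eq hμ ht.2.le] at hx
    calc μ ^ 3 * c * μ ^ (-(3 * (1 - 1 / r))) * (T / μ - t) ^ (-(3 * (1 - 1 / r)))
        = μ ^ 3 * (c * (μ ^ (-(3 * (1 - 1 / r))) * (T / μ - t) ^ (-(3 * (1 - 1 / r))))) := by ring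
      _ ≤ μ ^ 3 * ρ (μ * t) x := mul_le_mul_of_nonneg_left hx hμ3pos.le

end Summit.AtomisticToContinuum.HydrodynamicLimit.Theorems

end
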